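import Summits.NavierStokesRegularity.NavierStokesRegularity.Theorems.StrainDoorsNearFieldClosers
import Summits.NavierStokesRegularity.NavierStokesRegularity.Theorems.StrainDoorsPressureSource
import Literature.Analysis.FluidPDE.BKMClassGradientContinuity
import Literature.Analysis.FluidPDE.BKMClassTimeDerivativeL2
import Literature.Analysis.FluidPDE.VorticityCalculus
import Literature.Analysis.FluidPDE.NSCriticalClosureTao
import Literature.Analysis.FluidPDE.NSBoundedMildAnalytic
import Literature.Analysis.FluidPDE.NSLocalLerayBackwardUniqueness
import Literature.Analysis.FluidPDE.ForcedOseenRepresentationClassical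
import Literature.Analysis.FluidPDE.OseenMildUniqueness
import Literature.Analysis.FluidPDE.NSLerayStrongLocalExistence
import Literature.Analysis.FluidPDE.HarmonicLiouvilleLp
import Literature.Analysis.FluidPDE.EnstrophySplitting
import Summits.NavierStokesRegularity.NavierStokesRegularity.Theorems.LocalTraceTubeDoorHarmonicSpeed
import HarnessLib

/-!
# Strain doors — THE DOOR FRAME IS ANALYTIC, OF ZERO Q-MASS, AND PRESSURELESS WHEN `Δp ≡ 0`

LEAD S-door engine plate (ns-s30-p1 g5) for nsreg-p1 g34's ROUND-49 «rigidity of favourable segregation».  The standing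
frame of the doors D5–D11 is: a classical unforced solution `(u,p)` on `[0,T)` with viscosity `ν > 0`, Sobolev-bounded on
every `[0,T'']`, `T'' < T` (`IsClassicalNSSolutionOn (Ico 0 T) ν 0 u p`, `∀ T'' < T, HasBoundedSobolevNormsOn (Icc 0 T'') u`).
ROUND-49 §25 (`qDensity_eq_zero_of_D11_hypothesis_of_analytic`) carries two EXPLICIT hypotheses on the Q-field density
`q(t,·) = ½|ω|² − |S|²` — real-analyticity on `ℝ³` and integrability — and leaves the «pressureless endgame» untyped.
This file proves, in the frame and from tree theorems only:

* §26 SPATIAL ANALYTICITY.  `analyticOnNhd_slice_of_frame`: `u(t,·)` is real-analytic on `ℝ³` for every `0 < t < T`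
  (Masuda 1967 / Kahane 1969 for this class; route = the tree's Lemarié-Rieusset Thm 9.12 engine
  `lemarieRieusset2016_local_analyticity_holds` + `ae_eq_forced_oseenMild` + `oseenMild_bounded_unique`, exactly as in
  the tree's `QuarterLawTypeINegative.analyticOnNhd_slice_of_classical` (Tao frame), with the Leray–Hopf/decay inputs
  replaced by the frame's Sobolev bounds: `n = 0` (energy) and `H² ⊂ L^∞`
  (`exists_forall_norm_le_of_hasBoundedSobolevNormsOn`)); hence `analyticOnNhd_qDensity_of_frame`
  (`q = |ω|² − |∇u|²_F` is a polynomial in `∇u`).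
* §27 INTEGRABILITY AND ZERO MASS.  `integrable_qDensity_of_frame` (`|q| ≤ |∇u|²_F`, Sobolev `n = 1`) and
  `integral_qDensity_eq_zero_of_frame`: `∫ q(t,x) dx = 0` at every `t ∈ [0,T)`, i.e. `∫|S|² = ½∫|ω|²`
  (Doering–Gibbon (1.4.20)–(1.4.21), tree `integral_frobeniusNormSq_fderiv_eq_integral_norm_curl_sq`, Sobolev `n ≤ 2`).
* §27′ THE PRESSURELESS INSTANT.  `lintegral_enorm_gradient_pressure_sq_lt_top_of_frame` (`∇p(t) ∈ L²`, tree
  `exists_lintegral_enorm_gradient_pressure_sq_le`, Majda–Bertozzi Thm 3.5);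
  `fderiv_eq_zero_of_laplacian_eq_zero_of_gradient_sq_integrable` (a `C³` scalar with `Δf ≡ 0` and `∇f ∈ L²` has
  `∇f ≡ 0`: `∂ₐΔ = Δ∂ₐ` + Liouville in `L²`, tree `eq_zero_of_harmonic_memLp`); hence in the frame `Δp(t,·) ≡ 0`
  forces `∇p(t,·) ≡ 0` (`gradient_pressure_eq_zero_of_laplacian_eq_zero_of_frame`) and the momentum equation at that
  instant is vector Burgers, `∂ₜu + (u·∇)u = νΔu` (`momentum_pressureless_of_laplacian_eq_zero_of_frame`).

The companion `StrainDoorsSegregationRigidityFrame.lean` feeds these into ROUND-49's §25 (D11 modulo nothing).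
HONEST FRAME: frame bookkeeping for a door HYPOTHESIS analysis; no regularity statement, no continuation criterion;
item 0056 `NoTypeII` / 10661 / NS regularity are NOT proved.  `--supports stmt-NavierStokesRegularity-0056 --as helper`.
-/

noncomputable section

open MeasureTheory Set Function Filter InnerProductSpace Metric
open scoped RealInnerProductSpace Laplacian ContDiff Topology ENNReal NNReal
open Real Literature.Analysis Literature.Analysis.FluidPDE Literature.Analysis.FluidPDE.VorticityDirectionDynamics

set_option linter.dupNamespace false

namespace Summit.NavierStokesRegularity.NavierStokesRegularity.Theorems.StrainDoors

/-! ## §26  Spatial analyticity of the slices in the door frame -/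

/-- support (frame): FINITE ENERGY on closed sub-slabs — the Sobolev bound `n = 0` on `[0,T']`, `T' < T`, read as
`∫⁻ ‖u(τ)‖² ≤ C < ∞` uniformly in `τ ∈ [0,T']`. -/
theorem exists_lintegral_enorm_sq_le_of_frame {T : ℝ}
    {u : ℝ → (EuclideanSpace ℝ (Fin 3)) → (EuclideanSpace ℝ (Fin 3))}
    (hSob : ∀ T'' < T, HasBoundedSobolevNormsOn (Icc 0 T'') u) {T' : ℝ} (hT' : T' < T) :
    ∃ C : ℝ≥0∞, C < ⊤ ∧ ∀ τ ∈ Icc 0 T', ∫⁻ x, ‖u τ x‖ₑ ^ 2 ≤ C := by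
  obtain ⟨C, hC⟩ := hSob T' hT' 0
  refine ⟨C, ENNReal.coe_lt_top, fun τ hτ => ?_⟩
  refine le_trans (le_of_eq (lintegral_congr fun x => ?_)) (hC τ hτ)
  rw [← ofReal_norm, ← norm_iteratedFDeriv_zero (𝕜 := ℝ) (f := u τ), ofReal_norm]

/-- ★★ SPATIAL ANALYTICITY IN THE DOOR FRAME (Masuda 1967 / Kahane 1969 for this class, here PROVED from the tree's
Lemarié-Rieusset Thm 9.12 engine).  A classical unforced solution on `[0,T)` with viscosity `ν > 0`, Sobolev-bounded
on every `[0,T'']`, `T'' < T` (the standing class of doors D5–D11), has REAL-ANALYTIC slices: `u(t,·)` is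
real-analytic on `ℝ³` for every `0 < t < T`.  Route (adapted from the tree's `analyticOnNhd_slice_of_classical`,
Tao frame): on the closed sub-slab `[0,(t+T)/2]` the solution is bounded (`H² ⊂ L^∞`,
`exists_forall_norm_le_of_hasBoundedSobolevNormsOn`) with finite energy (Sobolev bound `n = 0`), hence Oseen-mild from
`u(s₁)` at a base time `s₁ < t` (`ae_eq_forced_oseenMild`), and is identified (`oseenMild_bounded_unique`) with the
jointly real-analytic Picard solution from the bounded datum `u(s₁)` (`lemarieRieusset2016_local_analyticity_holds`). -/
theorem analyticOnNhd_slice_of_frame {ν T : ℝ} (hν : 0 < ν)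
    {u : ℝ → (EuclideanSpace ℝ (Fin 3)) → (EuclideanSpace ℝ (Fin 3))} {p : ℝ → (EuclideanSpace ℝ (Fin 3)) → ℝ}
    (hsol : IsClassicalNSSolutionOn (Ico 0 T) ν 0 u p) (hSob : ∀ T'' < T, HasBoundedSobolevNormsOn (Icc 0 T'') u)
    {t : ℝ} (ht : t ∈ Ioo 0 T) : AnalyticOnNhd ℝ (u t) univ := by
  -- adapted from Theorems/QuarterLawTypeI/Negative/LocallyDssBlowupExcluded.lean (`analyticOnNhd_slice_of_classical`)
  obtain ⟨ε, hε, C₀, hC₀, hloc⟩ := lemarieRieusset2016_local_analyticity_holds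
  have hT : 0 < T := ht.1.trans ht.2
  -- closed sub-slab `[0, T']`, `T' = (t + T)/2`: a uniform bound `B₀`
  set T' : ℝ := (t + T) / 2 with hT'def
  have hT'pos : 0 < T' := by rw [hT'def]; linarith [ht.1, ht.2]
  have hT'lt : T' < T := by rw [hT'def]; linarith [ht.2]
  have htT' : t < T' := by rw [hT'def]; linarith [ht.2]
  have hclq : IsClassicalNSSolutionOn (Icc 0 T') ν 0 u p :=
    hsol.mono (Icc_subset_Ico_right hT'lt) (uniqueDiffOn_Icc hT'pos)
  have hBq : HasBoundedSobolevNormsOn (Icc 0 T') u := hSob T' hT'lt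
  obtain ⟨B₀, hB₀0, hB₀⟩ := exists_forall_norm_le_of_hasBoundedSobolevNormsOn hclq hBq
  obtain ⟨CE, hCEtop, hCE⟩ := exists_lintegral_enorm_sq_le_of_frame hSob hT'lt
  set Mb : ℝ := B₀ + 1 with hMb
  have hMb0 : 0 < Mb := by rw [hMb]; linarith
  set h : ℝ := ε * ν / Mb ^ 2 with hh
  have hh0 : 0 < h := by positivity
  -- base time `s₁ = t - δ`
  set δ : ℝ := min (t / 2) (h / 2) with hδ
  have hδ0 : 0 < δ := lt_min (by linarith [ht.1]) (by linarith)
  have hδt : δ < t := (min_le_left _ _).trans_lt (by linarith [ht.1])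
  have hδh : δ < h := (min_le_right _ _).trans_lt (by linarith)
  set s₁ : ℝ := t - δ with hs₁
  have hs₁0 : 0 < s₁ := by rw [hs₁]; linarith
  have hs₁T' : s₁ < T' := by rw [hs₁]; linarith
  -- the translate `v τ = u (τ + s₁)` on the closed slab `[0, b]`, `b = T' - s₁`
  set b : ℝ := T' - s₁ with hb
  have hb0 : 0 < b := by rw [hb]; linarith
  have hδb : δ < b := by rw [hb, hs₁]; linarith
  set v : ℝ → EuclideanSpace ℝ (Fin 3) → EuclideanSpace ℝ (Fin 3) := fun τ => u (τ + s₁) with hv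
  have hclo : IsClassicalNSSolutionOn (Ioo 0 T) ν 0 u p :=
    hsol.mono Ioo_subset_Ico_self (uniqueDiffOn_Ioo 0 T)
  have hclv : IsClassicalNSSolutionOn (Icc 0 b) ν 0 v (fun τ => p (τ + s₁)) :=
    hclo.translate_Icc_of_Ioo hs₁0 hb0 (by rw [hb]; linarith)
  have hvM : ∀ τ ∈ Icc 0 b, ∀ x, ‖v τ x‖ ≤ Mb := by
    intro τ hτ x
    have hτs : τ + s₁ ∈ Icc 0 T' := ⟨by linarith [hτ.1], by rw [hb] at hτ; linarith [hτ.2]⟩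
    exact (hB₀ (τ + s₁) hτs x).trans (by rw [hMb]; linarith)
  have hvE : ∃ C : ℝ≥0∞, C < ⊤ ∧ ∀ τ ∈ Icc 0 b, ∫⁻ x, ‖v τ x‖ₑ ^ 2 ≤ C := by
    refine ⟨CE, hCEtop, fun τ hτ => ?_⟩
    have hτs : τ + s₁ ∈ Icc 0 T' := ⟨by linarith [hτ.1], by rw [hb] at hτ; linarith [hτ.2]⟩
    exact hCE (τ + s₁) hτs
  -- Oseen-mild from the datum `v 0` (zero force)
  have hmild : ∀ τ ∈ Ioc 0 b, v τ =ᵐ[volume] fun x =>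
      UnboundedOperators.heatExtension (v 0) (ν * τ) x - oseenDuhamel ν 0 v v τ x := by
    intro τ hτ
    have hg0 : ∀ τ' ∈ Icc 0 b, ∀ y : EuclideanSpace ℝ (Fin 3),
        ‖(0 : ℝ → EuclideanSpace ℝ (Fin 3) → EuclideanSpace ℝ (Fin 3)) τ' y‖ ≤ 0 := by
      intro τ' _ y
      simp
    have h1 := hclv.ae_eq_forced_oseenMild hν hb0 (g := 0) (G := 0) continuous_const hg0
      (fun τ' _ => fun θ _ => by simp) (G₂ := 0) ENNReal.zero_ne_top
      (fun τ' _ => by simp) hvE hMb0 hvM hτ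
    have hF : ∀ x, forceDuhamel ν 0 (0 : ℝ → EuclideanSpace ℝ (Fin 3) → EuclideanSpace ℝ (Fin 3)) τ x = 0 := by
      intro x
      have h2 := norm_forceDuhamel_le (g := (0 : ℝ → EuclideanSpace ℝ (Fin 3) → EuclideanSpace ℝ (Fin 3)))
        (G := 0) hν hτ.1.le
        (fun τ' _ y => by simp) x
      rw [mul_zero] at h2
      exact norm_le_zero_iff.1 h2
    filter_upwards [h1] with x hx
    rw [hx, hF x, add_zero]
  -- the local analytic solution from `v 0`
  have hcontv : ∀ τ ∈ Icc 0 b, Continuous (v τ) := fun τ hτ =>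
    (hclv.contDiff_velocity hτ).continuous
  have ha_meas : AEStronglyMeasurable (v 0) volume :=
    (hcontv 0 ⟨le_rfl, hb0.le⟩).aestronglyMeasurable
  have ha_bd : eLpNorm (v 0) ∞ volume ≤ ENNReal.ofReal Mb := by
    rw [eLpNorm_exponent_top]
    exact eLpNormEssSup_le_of_ae_bound (Eventually.of_forall fun x => hvM 0 ⟨le_rfl, hb0.le⟩ x)
  obtain ⟨vl, hvl_an, hvl_eq, hvl_bd⟩ := hloc hν 0 hMb0 ha_meas ha_bd
  -- the common window `(0, T₂)`, `T₂ = min h b ∋ δ`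
  set T₂ : ℝ := min h b with hT₂
  have hδT₂ : δ < T₂ := lt_min hδh hδb
  have hT₂h : T₂ ≤ 0 + ε * ν / Mb ^ 2 := by rw [zero_add]; exact min_le_left _ _
  have hT₂b : T₂ ≤ b := min_le_right _ _
  set M' : ℝ := max Mb (C₀ * Mb) with hM'
  have hM'0 : 0 ≤ M' := hMb0.le.trans (le_max_left _ _)
  have hum : AEStronglyMeasurable (uncurry v) (volume.restrict (Ioo 0 T₂ ×ˢ univ)) :=
    (hclv.smooth_velocity.continuousOn.mono
      (prod_mono (fun τ hτ => ⟨hτ.1.le, hτ.2.le.trans hT₂b⟩) Subset.rfl)).aestronglyMeasurable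
      (measurableSet_Ioo.prod MeasurableSet.univ)
  have hvm : AEStronglyMeasurable (uncurry vl) (volume.restrict (Ioo 0 T₂ ×ˢ univ)) :=
    (hvl_an.continuousOn.mono (prod_mono (Ioo_subset_Ioo_right hT₂h) Subset.rfl)).aestronglyMeasurable
      (measurableSet_Ioo.prod MeasurableSet.univ)
  have huM : ∀ τ ∈ Ioo 0 T₂, ∀ y, ‖v τ y‖ ≤ M' := fun τ hτ y =>
    (hvM τ ⟨hτ.1.le, hτ.2.le.trans hT₂b⟩ y).trans (le_max_left _ _)
  have hvlM : ∀ τ ∈ Ioo 0 T₂, ∀ y, ‖vl τ y‖ ≤ M' := fun τ hτ y =>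
    (hvl_bd τ ⟨hτ.1, hτ.2.trans_le hT₂h⟩ y).trans (le_max_right _ _)
  have hu : ∀ τ ∈ Ioo 0 T₂, v τ =ᵐ[volume] fun x =>
      UnboundedOperators.heatExtension (v 0) (ν * (τ - 0)) x - oseenDuhamel ν 0 v v τ x := by
    intro τ hτ
    rw [sub_zero]
    exact hmild τ ⟨hτ.1, hτ.2.le.trans hT₂b⟩
  have hv' : ∀ τ ∈ Ioo 0 T₂, vl τ =ᵐ[volume] fun x =>
      UnboundedOperators.heatExtension (v 0) (ν * (τ - 0)) x - oseenDuhamel ν 0 vl vl τ x :=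
    fun τ hτ => Eventually.of_forall fun x => hvl_eq τ ⟨hτ.1, hτ.2.trans_le hT₂h⟩ x
  have heq := oseenMild_bounded_unique
    (U := fun τ x => UnboundedOperators.heatExtension (v 0) (ν * (τ - 0)) x)
    hν hM'0 hum hvm huM hvlM hu hv' δ ⟨hδ0, hδT₂⟩
  have hδwin : δ ∈ Ioo 0 (0 + ε * ν / Mb ^ 2) := ⟨hδ0, hδT₂.trans_le hT₂h⟩
  have hvlδ : AnalyticOnNhd ℝ (vl δ) univ := analyticOnNhd_slice hvl_an hδwin
  have hvδ : v δ = u t := by simp [hv, hs₁]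
  have hut : u t = vl δ := by
    rw [← hvδ]
    exact (Continuous.ae_eq_iff_eq volume (hcontv δ ⟨hδ0.le, hδb.le⟩)
      (continuousOn_univ.1 hvlδ.continuousOn)).1 heq
  rw [hut]
  exact hvlδ

/-- ★ THE Q-FIELD IS REAL-ANALYTIC IN THE DOOR FRAME: `q(t,·) = ½|ω|² − |S|² (= |ω|² − |∇u|²_F)` is real-analytic on
`ℝ³` at every `0 < t < T` (discharges the `AnalyticOnNhd` hypothesis of §25 in the frame). -/
theorem analyticOnNhd_qDensity_of_frame {ν T : ℝ} (hν : 0 < ν)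
    {u : ℝ → (EuclideanSpace ℝ (Fin 3)) → (EuclideanSpace ℝ (Fin 3))} {p : ℝ → (EuclideanSpace ℝ (Fin 3)) → ℝ}
    (hsol : IsClassicalNSSolutionOn (Ico 0 T) ν 0 u p) (hSob : ∀ T'' < T, HasBoundedSobolevNormsOn (Icc 0 T'') u)
    {t : ℝ} (ht : t ∈ Ioo 0 T) : AnalyticOnNhd ℝ (qDensity u t) univ := by
  have hu : AnalyticOnNhd ℝ (u t) univ := analyticOnNhd_slice_of_frame hν hsol hSob ht
  have hcurl : AnalyticOnNhd ℝ (curl (u t)) univ := analyticOnNhd_curl hu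
  have h1 : AnalyticOnNhd ℝ (fun y => ‖curl (u t) y‖ ^ 2) univ :=
    AnalyticOnNhd.congr isOpen_univ
      (LocalHelicityTubeDoorFrobeniusWindowRigidityWindow.analyticOnNhd_inner hcurl hcurl)
      fun y _ => real_inner_self_eq_norm_sq _
  have h2 := LocalTraceTubeDoorHarmonicSpeed.analyticOnNhd_frobeniusNormSq_fderiv hu
  have hq : qDensity u t = fun y => ‖curl (u t) y‖ ^ 2 - frobeniusNormSq (fderiv ℝ (u t) y) := by
    funext y; unfold qDensity strainNormSq; ring
  rw [hq]
  exact h1.sub h2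

/-! ## §27  Integrability and zero total mass of the Q-field in the door frame -/

/-- support: for a classical solution on `[0,T)` the Q-field density `q(t,·) = ½|ω|² − |S|² (= Δp(t,·))` is smooth in
space at every `t ∈ [0,T)`. -/
theorem contDiff_qDensity_of_classical {ν T : ℝ}
    {u : ℝ → (EuclideanSpace ℝ (Fin 3)) → (EuclideanSpace ℝ (Fin 3))} {p : ℝ → (EuclideanSpace ℝ (Fin 3)) → ℝ}
    (hsol : IsClassicalNSSolutionOn (Ico 0 T) ν 0 u p) {t : ℝ} (ht : t ∈ Ico 0 T) :
    ContDiff ℝ ∞ (qDensity u t) := by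
  have hS : UniqueDiffOn ℝ (Ico (0 : ℝ) T) := uniqueDiffOn_Ico 0 T
  have hΔs : ContDiff ℝ ∞ (fun y => (Δ (p t)) y) := (hsol.smooth_pressure.laplacian hS).contDiff_slice ht
  rw [qDensity_eq_laplacian_pressure_fun hsol ht]
  exact hΔs

/-- support: … hence continuous in space. -/
theorem continuous_qDensity_of_classical {ν T : ℝ}
    {u : ℝ → (EuclideanSpace ℝ (Fin 3)) → (EuclideanSpace ℝ (Fin 3))} {p : ℝ → (EuclideanSpace ℝ (Fin 3)) → ℝ}
    (hsol : IsClassicalNSSolutionOn (Ico 0 T) ν 0 u p) {t : ℝ} (ht : t ∈ Ico 0 T) :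
    Continuous (qDensity u t) :=
  (contDiff_qDensity_of_classical hsol ht).continuous

/-- ★ FRAME BOOKKEEPING (discharges the `Integrable` hypothesis of §25 in the door frame).  For a classical unforced
solution on `[0,T)` that is Sobolev-bounded on every `[0,T'']`, `T'' < T` (the standing class of doors D5–D11), the
Q-field density `q(t,·) = ½|ω|² − |S|²` is INTEGRABLE on `ℝ³` at every `t ∈ [0,T)`: `|q| ≤ |∇u|²_F` pointwise
(`abs_qDensity_le`) and `∫ |∇u(t)|²_F < ∞` (`integrable_frobeniusNormSq_fderiv_of_frame`, Sobolev bound `n = 1`). -/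
theorem integrable_qDensity_of_frame {ν T : ℝ}
    {u : ℝ → (EuclideanSpace ℝ (Fin 3)) → (EuclideanSpace ℝ (Fin 3))} {p : ℝ → (EuclideanSpace ℝ (Fin 3)) → ℝ}
    (hsol : IsClassicalNSSolutionOn (Ico 0 T) ν 0 u p) (hSob : ∀ T'' < T, HasBoundedSobolevNormsOn (Icc 0 T'') u)
    {t : ℝ} (ht : t ∈ Ico 0 T) : Integrable (qDensity u t) := by
  refine (integrable_frobeniusNormSq_fderiv_of_frame hsol hSob ht).mono'
    (continuous_qDensity_of_classical hsol ht).aestronglyMeasurable (Eventually.of_forall fun x => ?_)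
  rw [Real.norm_eq_abs]
  exact abs_qDensity_le u t x

/-- support (frame): ENSTROPHY IN TWO FORMS.  In the door frame `∫ |∇u(t)|²_F = ∫ |ω(t)|²` at every `t ∈ [0,T)`
(the tree's `integral_frobeniusNormSq_fderiv_eq_integral_norm_curl_sq` for `C²` divergence-free fields with
`u, ∇u, ∇²u ∈ L²` — Doering–Gibbon (1.4.20)–(1.4.21); the three `L²` bounds are the Sobolev bounds `n = 0,1,2` on `[0,t]`). -/
theorem integral_frobeniusNormSq_eq_integral_norm_curl_sq_of_frame {ν T : ℝ}
    {u : ℝ → (EuclideanSpace ℝ (Fin 3)) → (EuclideanSpace ℝ (Fin 3))} {p : ℝ → (EuclideanSpace ℝ (Fin 3)) → ℝ}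
    (hsol : IsClassicalNSSolutionOn (Ico 0 T) ν 0 u p) (hSob : ∀ T'' < T, HasBoundedSobolevNormsOn (Icc 0 T'') u)
    {t : ℝ} (ht : t ∈ Ico 0 T) :
    ∫ x, frobeniusNormSq (fderiv ℝ (u t) x) = ∫ x, ‖curl (u t) x‖ ^ 2 := by
  have hsm : ContDiff ℝ 2 (u t) := (hsol.contDiff_velocity ht).of_le (by norm_cast)
  have hB : HasBoundedSobolevNormsOn (Icc 0 t) u := hSob t ht.2
  have htI : t ∈ Icc 0 t := ⟨ht.1, le_rfl⟩
  have hn : ∀ n : ℕ, ∫⁻ x, ‖iteratedFDeriv ℝ n (u t) x‖ₑ ^ 2 < ⊤ := fun n => by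
    obtain ⟨C, hC⟩ := hB n
    exact (hC t htI).trans_lt ENNReal.coe_lt_top
  have h0 : ∫⁻ x, ‖u t x‖ₑ ^ 2 < ⊤ := by
    refine lt_of_le_of_lt (le_of_eq (lintegral_congr fun x => ?_)) (hn 0)
    rw [← ofReal_norm, ← norm_iteratedFDeriv_zero (𝕜 := ℝ) (f := u t), ofReal_norm]
  exact integral_frobeniusNormSq_fderiv_eq_integral_norm_curl_sq hsm (hsol.divFree t ht) h0 (hn 1) (hn 2)

/-- support (frame): `x ↦ |ω(t,x)|²` is integrable at every `t ∈ [0,T)` (`|ω|² ≤ 2|∇u|²_F`). -/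
theorem integrable_norm_curl_sq_of_frame {ν T : ℝ}
    {u : ℝ → (EuclideanSpace ℝ (Fin 3)) → (EuclideanSpace ℝ (Fin 3))} {p : ℝ → (EuclideanSpace ℝ (Fin 3)) → ℝ}
    (hsol : IsClassicalNSSolutionOn (Ico 0 T) ν 0 u p) (hSob : ∀ T'' < T, HasBoundedSobolevNormsOn (Icc 0 T'') u)
    {t : ℝ} (ht : t ∈ Ico 0 T) : Integrable (fun x => ‖curl (u t) x‖ ^ 2) := by
  have hsm : ContDiff ℝ 1 (u t) := (hsol.contDiff_velocity ht).of_le (by norm_cast)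
  have hc : Continuous fun x => ‖curl (u t) x‖ ^ 2 := ((continuous_curl hsm).norm).pow 2
  refine ((integrable_frobeniusNormSq_fderiv_of_frame hsol hSob ht).const_mul 2).mono' hc.aestronglyMeasurable
    (Eventually.of_forall fun x => ?_)
  rw [Real.norm_eq_abs, abs_of_nonneg (sq_nonneg _)]
  exact norm_curl_sq_le_two_mul_frobeniusNormSq (u t) x

/-- ★ FRAME BOOKKEEPING: THE Q-FIELD HAS ZERO TOTAL MASS.  In the door frame, at every `t ∈ [0,T)`,
`∫ q(t,x) dx = 0`, i.e. `∫ |S(t)|²_F = ½ ∫ |ω(t)|²` (`q = |ω|² − |∇u|²_F` pointwise, and the two enstrophies agree). -/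
theorem integral_qDensity_eq_zero_of_frame {ν T : ℝ}
    {u : ℝ → (EuclideanSpace ℝ (Fin 3)) → (EuclideanSpace ℝ (Fin 3))} {p : ℝ → (EuclideanSpace ℝ (Fin 3)) → ℝ}
    (hsol : IsClassicalNSSolutionOn (Ico 0 T) ν 0 u p) (hSob : ∀ T'' < T, HasBoundedSobolevNormsOn (Icc 0 T'') u)
    {t : ℝ} (ht : t ∈ Ico 0 T) : ∫ x, qDensity u t x = 0 := by
  have hq : ∀ x, qDensity u t x = ‖curl (u t) x‖ ^ 2 - frobeniusNormSq (fderiv ℝ (u t) x) := fun x => by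
    unfold qDensity strainNormSq; ring
  have hIf := integrable_frobeniusNormSq_fderiv_of_frame hsol hSob ht
  have hIc := integrable_norm_curl_sq_of_frame hsol hSob ht
  simp_rw [hq]
  rw [integral_sub hIc hIf, sub_eq_zero, integral_frobeniusNormSq_eq_integral_norm_curl_sq_of_frame hsol hSob ht]

/-! ## §27′  The pressure gradient is square-integrable; `Δp ≡ 0` forces a pressureless instant -/

/-- support (frame): THE PRESSURE GRADIENT IS SQUARE-INTEGRABLE at every `t ∈ [0,T)` in the door frame
(`∇p = νΔu − (u·∇)u − ∂ₜu` on the closed sub-slab `[0,(t+T)/2]`; tree `exists_lintegral_enorm_gradient_pressure_sq_le`,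
Majda–Bertozzi Thm 3.5). -/
theorem lintegral_enorm_gradient_pressure_sq_lt_top_of_frame {ν T : ℝ} (hν : 0 < ν)
    {u : ℝ → (EuclideanSpace ℝ (Fin 3)) → (EuclideanSpace ℝ (Fin 3))} {p : ℝ → (EuclideanSpace ℝ (Fin 3)) → ℝ}
    (hsol : IsClassicalNSSolutionOn (Ico 0 T) ν 0 u p) (hSob : ∀ T'' < T, HasBoundedSobolevNormsOn (Icc 0 T'') u)
    {t : ℝ} (ht : t ∈ Ico 0 T) : ∫⁻ x, ‖gradient (p t) x‖ₑ ^ 2 < ⊤ := by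
  set T' : ℝ := (t + T) / 2 with hT'def
  have hT'pos : 0 < T' := by rw [hT'def]; linarith [ht.1, ht.2]
  have hT'lt : T' < T := by rw [hT'def]; linarith [ht.2]
  have htT' : t ≤ T' := by rw [hT'def]; linarith [ht.2]
  have hclq : IsClassicalNSSolutionOn (Icc 0 T') ν 0 u p :=
    hsol.mono (Icc_subset_Ico_right hT'lt) (uniqueDiffOn_Icc hT'pos)
  obtain ⟨Λ, hΛtop, hΛ⟩ := hclq.exists_lintegral_enorm_gradient_pressure_sq_le hν.le hT'pos (hSob T' hT'lt)
  exact (hΛ t ⟨ht.1, htT'⟩).trans_lt hΛtop.lt_top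

/-- support: a smooth scalar on `ℝ³` whose Laplacian vanishes identically and whose gradient is square-integrable has
ZERO GRADIENT (each directional derivative `∂ₐp` is harmonic — `∂ₐΔ = Δ∂ₐ` — and in `L²`, hence `0` by Liouville in
`L²`, tree `eq_zero_of_harmonic_memLp`). -/
theorem fderiv_eq_zero_of_laplacian_eq_zero_of_gradient_sq_integrable {f : EuclideanSpace ℝ (Fin 3) → ℝ}
    (hf : ContDiff ℝ 3 f) (hΔ : ∀ x, (Δ f) x = 0) (hL2 : ∫⁻ x, ‖gradient f x‖ₑ ^ 2 < ⊤) (x : EuclideanSpace ℝ (Fin 3)) :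
    fderiv ℝ f x = 0 := by
  -- every directional derivative vanishes identically
  suffices h : ∀ a : EuclideanSpace ℝ (Fin 3), (fun y => fderiv ℝ f y a) = 0 by
    ext a
    have := congrFun (h a) x
    simpa using this
  intro a
  set g : EuclideanSpace ℝ (Fin 3) → ℝ := fun y => fderiv ℝ f y a with hg
  have hg2 : ContDiff ℝ 2 g := (hf.fderiv_right (m := 2) (by norm_num)).clm_apply contDiff_const
  -- `g` is harmonic: `Δ g = ∂ₐ (Δ f) = 0`
  have hΔf : Δ f = fun _ => (0 : ℝ) := funext hΔ
  have hharm : HarmonicOnNhd g univ := by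
    refine harmonicOnNhd_of_laplacian_eq_zero hg2 fun y => ?_
    rw [hg, ← fderiv_laplacian_apply_of_contDiff_three hf y a, hΔf]
    simp
  -- `g ∈ L²`: `|∂ₐ f| ≤ ‖a‖ ‖∇f‖`
  have hgc : Continuous g := hg2.continuous
  have hmem : MemLp g 2 volume := by
    refine ⟨hgc.aestronglyMeasurable, ?_⟩
    rw [eLpNorm_lt_top_iff_lintegral_rpow_enorm_lt_top two_ne_zero ENNReal.ofNat_ne_top]
    simp only [ENNReal.toReal_ofNat, ENNReal.rpow_ofNat]
    have hpt : ∀ y, ‖g y‖ₑ ^ 2 ≤ ENNReal.ofReal (‖a‖ ^ 2) * ‖gradient f y‖ₑ ^ 2 := by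
      intro y
      have h1 : ‖g y‖ ≤ ‖a‖ * ‖gradient f y‖ := by
        have : g y = ⟪gradient f y, a⟫ := by
          rw [hg]; simp [gradient, InnerProductSpace.toDual_symm_apply]
        rw [this]
        calc ‖⟪gradient f y, a⟫‖ ≤ ‖gradient f y‖ * ‖a‖ := norm_inner_le_norm _ _
          _ = ‖a‖ * ‖gradient f y‖ := mul_comm _ _
      have h2 : ‖g y‖ₑ ≤ ENNReal.ofReal ‖a‖ * ‖gradient f y‖ₑ := by
        rw [← ofReal_norm, ← ofReal_norm, ← ENNReal.ofReal_mul (norm_nonneg _)]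
        exact ENNReal.ofReal_le_ofReal h1
      calc ‖g y‖ₑ ^ 2 ≤ (ENNReal.ofReal ‖a‖ * ‖gradient f y‖ₑ) ^ 2 := pow_le_pow_left' h2 2
        _ = ENNReal.ofReal (‖a‖ ^ 2) * ‖gradient f y‖ₑ ^ 2 := by
            rw [mul_pow, ENNReal.ofReal_pow (norm_nonneg _)]
    calc ∫⁻ y, ‖g y‖ₑ ^ 2 ≤ ∫⁻ y, ENNReal.ofReal (‖a‖ ^ 2) * ‖gradient f y‖ₑ ^ 2 := lintegral_mono hpt
      _ = ENNReal.ofReal (‖a‖ ^ 2) * ∫⁻ y, ‖gradient f y‖ₑ ^ 2 := lintegral_const_mul' _ _ ENNReal.ofReal_ne_top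
      _ < ⊤ := ENNReal.mul_lt_top ENNReal.ofReal_lt_top hL2
  exact eq_zero_of_harmonic_memLp hharm (by norm_num) ENNReal.ofNat_ne_top hmem

/-- support (frame): if `Δp(t,·) ≡ 0` at a time `t ∈ [0,T)` in the door frame then `∇p(t,·) ≡ 0`. -/
theorem gradient_pressure_eq_zero_of_laplacian_eq_zero_of_frame {ν T : ℝ} (hν : 0 < ν)
    {u : ℝ → (EuclideanSpace ℝ (Fin 3)) → (EuclideanSpace ℝ (Fin 3))} {p : ℝ → (EuclideanSpace ℝ (Fin 3)) → ℝ}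
    (hsol : IsClassicalNSSolutionOn (Ico 0 T) ν 0 u p) (hSob : ∀ T'' < T, HasBoundedSobolevNormsOn (Icc 0 T'') u)
    {t : ℝ} (ht : t ∈ Ico 0 T) (hΔ : ∀ x, (Δ (p t)) x = 0) (x : EuclideanSpace ℝ (Fin 3)) :
    gradient (p t) x = 0 := by
  have hp3 : ContDiff ℝ 3 (p t) := (hsol.contDiff_pressure ht).of_le (by norm_cast)
  have hfd := fderiv_eq_zero_of_laplacian_eq_zero_of_gradient_sq_integrable hp3 hΔ
    (lintegral_enorm_gradient_pressure_sq_lt_top_of_frame hν hsol hSob ht) x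
  simp [gradient, hfd]

/-- ★ THE PRESSURELESS INSTANT (frame): if `Δp(t,·) ≡ 0` at a time `t ∈ [0,T)` in the door frame, the momentum equation at
that instant is the VECTOR BURGERS equation `∂ₜu + (u·∇)u = νΔu` pointwise on `ℝ³` (the pressure gradient drops out). -/
theorem momentum_pressureless_of_laplacian_eq_zero_of_frame {ν T : ℝ} (hν : 0 < ν)
    {u : ℝ → (EuclideanSpace ℝ (Fin 3)) → (EuclideanSpace ℝ (Fin 3))} {p : ℝ → (EuclideanSpace ℝ (Fin 3)) → ℝ}
    (hsol : IsClassicalNSSolutionOn (Ico 0 T) ν 0 u p) (hSob : ∀ T'' < T, HasBoundedSobolevNormsOn (Icc 0 T'') u)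
    {t : ℝ} (ht : t ∈ Ico 0 T) (hΔ : ∀ x, (Δ (p t)) x = 0) (x : EuclideanSpace ℝ (Fin 3)) :
    timeDerivWithin (Ico 0 T) u t x + convect (u t) (u t) x = ν • (Δ (u t)) x := by
  have hm := hsol.momentum t ht x
  rw [gradient_pressure_eq_zero_of_laplacian_eq_zero_of_frame hν hsol hSob ht hΔ x] at hm
  simpa using hm

end Summit.NavierStokesRegularity.NavierStokesRegularity.Theorems.StrainDoors

end
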